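import Summits.NavierStokesRegularity.NavierStokesRegularity.Theorems.TargetDepletionLadderBoundedSobolevData
import Literature.Analysis.FluidPDE.SobolevWholeSpace
import HarnessLib

/-!
# Crux `Target` (stmt-NavierStokesRegularity-1217), line `depletion_ladder`, stub S1 (registered class):
# `L⁴` data of a registered field — `‖curl u‖⁴ ∈ L¹` and `‖Du‖⁴ ∈ L¹`

`--supports stmt-NavierStokesRegularity-1217` (seat leafhand-ns-poloidalwindowdoor-3 g0, cell decomp-ns; tools
for the last step of the registered-class programme for `stub_depletionBelowHalf`: the convergence of
the stretching integral under mollification needs the three factors of `⟪ω, Du ω⟫` in `L² ∩ L⁴`).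

* `integral_mul_le_sqrt_mul_sqrt` — Cauchy–Schwarz in the form used downstream: for continuous
  `f, g ≥ 0` with `f², g² ∈ L¹`, `fg ∈ L¹` and `∫ fg ≤ √(∫f²) √(∫g²)`.
* `integrable_norm_pow_four_of_sobolev` — for `f ∈ C¹(ℝ³; ℝ³)` with `‖f‖² ∈ L¹` and `|Df|²_F ∈ L¹`:
  `‖f‖⁶ ∈ L¹` (the tree's whole-space Sobolev inequality `eLpNorm_six_le_eLpNorm_fderiv_two`) and hence
  `‖f‖⁴ = ‖f‖·‖f‖³ ∈ L¹` (Cauchy–Schwarz).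
* `integrable_norm_curl_pow_four`, `integrable_norm_fderiv_pow_four` — in the registered binders
  (`u ∈ C²`, `div u = 0`, `‖u‖ ≤ M`, `‖curl u‖² ∈ L¹`, `|∇ curl u|²_F ∈ L¹`): `‖curl u‖⁴ ∈ L¹` and
  `‖Du‖⁴ ∈ L¹` (operator norm; `‖Du‖² ≤ Σₖ‖∂ₖu‖²`, each `∂ₖu ∈ C¹ ∩ L²` with `|D∂ₖu|²_F ∈ L¹` by P3).

HONEST LABEL: helper tools; closes no stub; no Navier–Stokes content; `Target`, S3 and NS regularity
remain OPEN.

References: L. C. Evans, *PDE* (2010), §5.6.1 Thm. 1–2. [folklore]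
-/

noncomputable section

-- the summit and its single sub-problem share the name (CONVENTIONS §1)
set_option linter.dupNamespace false

open Set Filter Topology MeasureTheory Module
open scoped RealInnerProductSpace ENNReal NNReal
open Literature.Analysis.FluidPDE

namespace Summit.NavierStokesRegularity.NavierStokesRegularity.Theorems.DepletionLadder.BoundedLFour

open Summit.NavierStokesRegularity.NavierStokesRegularity.Theorems.DepletionLadder.BoundedDivCurl
open Summit.NavierStokesRegularity.NavierStokesRegularity.Theorems.DepletionLadder.BoundedSobolevData

/-! ### Cauchy–Schwarz for nonnegative continuous functions -/

/-- **Cauchy–Schwarz**: for continuous `f, g ≥ 0` with `f², g² ∈ L¹`: `fg ∈ L¹` and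
`∫ fg ≤ √(∫f²) · √(∫g²)`. [folklore] -/
theorem integral_mul_le_sqrt_mul_sqrt {f g : EuclideanSpace ℝ (Fin 3) → ℝ} (hf : Continuous f)
    (hg : Continuous g) (hf0 : ∀ x, 0 ≤ f x) (hg0 : ∀ x, 0 ≤ g x)
    (hf2 : Integrable fun x => f x ^ 2) (hg2 : Integrable fun x => g x ^ 2) :
    Integrable (fun x => f x * g x) ∧
      ∫ x, f x * g x ≤ Real.sqrt (∫ x, f x ^ 2) * Real.sqrt (∫ x, g x ^ 2) := by
  have hfm : MemLp f 2 volume := (memLp_two_iff_integrable_sq hf.aestronglyMeasurable).2 hf2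
  have hgm : MemLp g 2 volume := (memLp_two_iff_integrable_sq hg.aestronglyMeasurable).2 hg2
  have hint : Integrable (fun x => f x * g x) :=
    memLp_one_iff_integrable.1 (MemLp.mul' hgm hfm)
  refine ⟨hint, ?_⟩
  have hfm' : MemLp f (ENNReal.ofReal 2) volume := by rwa [ENNReal.ofReal_ofNat]
  have hgm' : MemLp g (ENNReal.ofReal 2) volume := by rwa [ENNReal.ofReal_ofNat]
  have h := integral_mul_le_Lp_mul_Lq_of_nonneg Real.HolderConjugate.two_two
    (ae_of_all _ hf0) (ae_of_all _ hg0) hfm' hgm'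
  have e : ∀ (k : EuclideanSpace ℝ (Fin 3) → ℝ), (∫ x, k x ^ (2 : ℝ)) ^ (1 / (2 : ℝ)) =
      Real.sqrt (∫ x, k x ^ 2) := fun k => by
    rw [Real.sqrt_eq_rpow]
    congr 1
    exact integral_congr_ae (ae_of_all _ fun x => by simp)
  rw [e f, e g] at h
  exact h

/-! ### `L⁶` and `L⁴` from the Sobolev data -/

/-- **`‖f‖⁶ ∈ L¹`** for `f ∈ C¹(ℝ³; ℝ³)` with `‖f‖² ∈ L¹` and `|Df|²_F ∈ L¹` (whole-space Sobolev
inequality `‖f‖₆ ≤ K‖Df‖₂` of the tree). [cite: Evans2010, §5.6.1 Thm. 1–2] -/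
theorem integrable_norm_pow_six_of_sobolev {f : EuclideanSpace ℝ (Fin 3) → EuclideanSpace ℝ (Fin 3)}
    (hf : ContDiff ℝ 1 f) (h2 : Integrable fun x => ‖f x‖ ^ 2)
    (hD : Integrable fun x => frobeniusNormSq (fderiv ℝ f x)) :
    Integrable fun x => ‖f x‖ ^ 6 := by
  have hE : finrank ℝ (EuclideanSpace ℝ (Fin 3)) = 3 := finrank_euclideanSpace_fin
  have hfc : Continuous f := hf.continuous
  have hDc : Continuous (fderiv ℝ f) := hf.continuous_fderiv one_ne_zero
  have hm2 : MemLp f 2 volume := (memLp_two_iff_integrable_sq_norm hfc.aestronglyMeasurable).2 h2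
  have hD2 : Integrable fun x => ‖fderiv ℝ f x‖ ^ 2 := by
    refine hD.mono' (hDc.norm.pow 2).aestronglyMeasurable (ae_of_all _ fun x => ?_)
    rw [Real.norm_of_nonneg (sq_nonneg _)]
    exact sq_opNorm_le_frobeniusNormSq _
  have hmD : MemLp (fderiv ℝ f) 2 volume :=
    (memLp_two_iff_integrable_sq_norm hDc.aestronglyMeasurable).2 hD2
  have hsob := eLpNorm_six_le_eLpNorm_fderiv_two (volume : Measure (EuclideanSpace ℝ (Fin 3)))
    hE hf hm2.eLpNorm_lt_top
  have h6 : eLpNorm f 6 volume < ⊤ :=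
    lt_of_le_of_lt hsob (ENNReal.mul_lt_top ENNReal.coe_lt_top hmD.eLpNorm_lt_top)
  have hm6 : MemLp f 6 volume := ⟨hfc.aestronglyMeasurable, h6⟩
  have hm6' : MemLp f ((6 : ℕ) : ℝ≥0∞) volume := by simpa using hm6
  exact hm6'.integrable_norm_pow (by norm_num)

/-- **`‖f‖⁴ ∈ L¹`** for `f ∈ C¹(ℝ³; ℝ³)` with `‖f‖² ∈ L¹` and `|Df|²_F ∈ L¹`
(`‖f‖⁴ = ‖f‖ · ‖f‖³`, Cauchy–Schwarz with `‖f‖² ∈ L¹`, `‖f‖⁶ ∈ L¹`). [folklore] -/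
theorem integrable_norm_pow_four_of_sobolev {f : EuclideanSpace ℝ (Fin 3) → EuclideanSpace ℝ (Fin 3)}
    (hf : ContDiff ℝ 1 f) (h2 : Integrable fun x => ‖f x‖ ^ 2)
    (hD : Integrable fun x => frobeniusNormSq (fderiv ℝ f x)) :
    Integrable fun x => ‖f x‖ ^ 4 := by
  have h6 := integrable_norm_pow_six_of_sobolev hf h2 hD
  have hfc : Continuous f := hf.continuous
  have h3sq : Integrable fun x => (‖f x‖ ^ 3) ^ 2 := by
    refine h6.congr (ae_of_all _ fun x => ?_)
    show ‖f x‖ ^ 6 = (‖f x‖ ^ 3) ^ 2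
    ring
  obtain ⟨hi, -⟩ := integral_mul_le_sqrt_mul_sqrt hfc.norm (hfc.norm.pow 3) (fun x => norm_nonneg _)
    (fun x => pow_nonneg (norm_nonneg _) 3) h2 h3sq
  refine hi.congr (ae_of_all _ fun x => ?_)
  show ‖f x‖ * ‖f x‖ ^ 3 = ‖f x‖ ^ 4
  ring

/-! ### The registered field: `‖curl u‖⁴ ∈ L¹`, `‖Du‖⁴ ∈ L¹` -/

variable {u : EuclideanSpace ℝ (Fin 3) → EuclideanSpace ℝ (Fin 3)}

/-- **`‖curl u‖⁴ ∈ L¹`** (and `‖curl u‖⁶ ∈ L¹`) in the registered binders. [folklore] -/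
theorem integrable_norm_curl_pow_four (hu : ContDiff ℝ 2 u)
    (hZ : Integrable fun x => ‖curl u x‖ ^ 2)
    (hP : Integrable fun x => frobeniusNormSq (fderiv ℝ (curl u) x)) :
    Integrable (fun x => ‖curl u x‖ ^ 4) ∧ Integrable (fun x => ‖curl u x‖ ^ 6) :=
  ⟨integrable_norm_pow_four_of_sobolev (contDiff_one_curl_of_contDiff_two hu) hZ hP,
    integrable_norm_pow_six_of_sobolev (contDiff_one_curl_of_contDiff_two hu) hZ hP⟩

/-- `‖Du(x)‖² ≤ Σₖ ‖∂ₖu(x)‖²` (operator norm versus Frobenius norm in the standard frame).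
[folklore] -/
theorem norm_fderiv_sq_le_sum (x : EuclideanSpace ℝ (Fin 3)) :
    ‖fderiv ℝ u x‖ ^ 2 ≤ ∑ k, ‖fderiv ℝ u x (EuclideanSpace.basisFun (Fin 3) ℝ k)‖ ^ 2 := by
  rw [← frobeniusNormSq_eq_sum (EuclideanSpace.basisFun (Fin 3) ℝ)]
  exact sq_opNorm_le_frobeniusNormSq _

/-- **`‖Du‖⁴ ∈ L¹`** in the registered binders (`u ∈ C²`, `div u = 0`, `‖u‖ ≤ M`, `‖curl u‖² ∈ L¹`,
`|∇ curl u|²_F ∈ L¹`): `‖Du‖⁴ ≤ (Σₖ‖∂ₖu‖²)² ≤ 3 Σₖ ‖∂ₖu‖⁴` and each `∂ₖu ∈ C¹ ∩ L²` has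
`|D∂ₖu|²_F ∈ L¹` (P3). [folklore] -/
theorem integrable_norm_fderiv_pow_four (hu : ContDiff ℝ 2 u) (hdiv : VectorCalculus.IsDivFree u)
    {M : ℝ} (hM : ∀ x, ‖u x‖ ≤ M) (hZ : Integrable fun x => ‖curl u x‖ ^ 2)
    (hP : Integrable fun x => frobeniusNormSq (fderiv ℝ (curl u) x)) :
    Integrable fun x => ‖fderiv ℝ u x‖ ^ 4 := by
  have hu1 : ContDiff ℝ 1 u := hu.of_le (by norm_num)
  have hD : Integrable fun x => frobeniusNormSq (fderiv ℝ u x) :=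
    integrable_frobeniusNormSq_fderiv_of_bounded hu hdiv hM hZ
  -- the partial derivative fields are in `L⁴`
  have hk : ∀ k : Fin 3, Integrable fun x =>
      ‖fderiv ℝ u x (EuclideanSpace.basisFun (Fin 3) ℝ k)‖ ^ 4 := by
    intro k
    exact integrable_norm_pow_four_of_sobolev (contDiff_one_fderiv_apply hu _)
      (integrable_sq_norm_fderiv_apply hu hD k)
      (integrable_frobeniusNormSq_fderiv_partial hu hdiv hM hZ hP k).1
  have hsum : Integrable fun x =>
      3 * ∑ k, ‖fderiv ℝ u x (EuclideanSpace.basisFun (Fin 3) ℝ k)‖ ^ 4 :=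
    (integrable_finsetSum _ fun k _ => hk k).const_mul 3
  have hc : Continuous fun x => ‖fderiv ℝ u x‖ ^ 4 :=
    ((hu1.continuous_fderiv one_ne_zero).norm).pow 4
  refine hsum.mono' hc.aestronglyMeasurable (ae_of_all _ fun x => ?_)
  rw [Real.norm_of_nonneg (by positivity)]
  have h1 := norm_fderiv_sq_le_sum (u := u) x
  have h2 : (∑ k, ‖fderiv ℝ u x (EuclideanSpace.basisFun (Fin 3) ℝ k)‖ ^ 2) ^ 2 ≤
      3 * ∑ k, (‖fderiv ℝ u x (EuclideanSpace.basisFun (Fin 3) ℝ k)‖ ^ 2) ^ 2 := by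
    have h := sq_sum_le_card_mul_sum_sq (s := (Finset.univ : Finset (Fin 3)))
      (f := fun k => ‖fderiv ℝ u x (EuclideanSpace.basisFun (Fin 3) ℝ k)‖ ^ 2)
    simpa using h
  calc ‖fderiv ℝ u x‖ ^ 4 = (‖fderiv ℝ u x‖ ^ 2) ^ 2 := by ring
    _ ≤ (∑ k, ‖fderiv ℝ u x (EuclideanSpace.basisFun (Fin 3) ℝ k)‖ ^ 2) ^ 2 :=
        pow_le_pow_left₀ (sq_nonneg _) h1 2
    _ ≤ 3 * ∑ k, (‖fderiv ℝ u x (EuclideanSpace.basisFun (Fin 3) ℝ k)‖ ^ 2) ^ 2 := h2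
    _ = 3 * ∑ k, ‖fderiv ℝ u x (EuclideanSpace.basisFun (Fin 3) ℝ k)‖ ^ 4 := by
        congr 1
        refine Finset.sum_congr rfl fun k _ => ?_
        ring
    _ = (fun x => 3 * ∑ k, ‖fderiv ℝ u x (EuclideanSpace.basisFun (Fin 3) ℝ k)‖ ^ 4) x := rfl

end Summit.NavierStokesRegularity.NavierStokesRegularity.Theorems.DepletionLadder.BoundedLFour

end
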